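import Literature.IUT.HodgeTheaters.GlobalFrobenioidsRealifyRlfEquiv
import Literature.AlgebraicGeometry.Frobenioids.ArithmeticDegreeRealification
import HarnessLib

/-!
# [IUTchI] Example 3.5 (i) ↔ [FrdI] Ex 6.3 / Thm 6.4 (i): the arithmetic degree read in the coordinates
# `log⊢_mod(p_v) ↦ 1` of `Φ_{𝒞⊩_mod}`, and along THE isomorphism `Ψ : Φ(L)^rlf ≃ Φ_{𝒞⊩_mod}` (PROOF-ONLY)

Mochizuki, *Inter-universal Teichmüller theory I*, §3, Example 3.5 (i), kurims manuscript (May 2020) p. 84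
([IUTchI] Ex 3.5 (i) p.84) [claim: Mochizuki2012, status: disputed]: "the submonoid `Φ_{𝒞⊩_mod,v}` of `Φ_{𝒞⊩_mod}`
corresponding to `v ∈ V_mod` is naturally isomorphic to `ord(𝒪^▷_{(F_mod)_v})^pf ⊗ ℝ_{≥0}`", "`p_v` determines an
element `log⊢_mod(p_v) ∈ Φ_{𝒞⊩_mod,v}`"; Mochizuki, *The geometry of Frobenioids I*, Kyushu J. Math. **62** (2008),
Ex 6.3 p. 113 (the arithmetic degree `deg^arith_L`: at a nonarchimedean `v` "the natural logarithm of the cardinality"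
of `𝒪_v/(λ)`, at an archimedean `v` the weight `[F_v : ℝ]`) and Thm 6.4 (i) p. 115 ("the homomorphism
`(Φ^rlf)^gp(L) = ArithDiv_ℝ(L) → ℝ` given by `deg_L^arith`").

PROOF-ONLY (no `def`, no instance; abc-iut-w4-d073 gen 5; the degree-level residual of the merge-debt item LC-L5-1
«`Φ(L)^rlf ≃* Φ_{𝒞⊩_mod}` under `Φ(L)`», left open by `GlobalFrobenioidsRealifyRlfEquiv.lean`).  Notation as there:
`Φ(L) = EffArithDivisor L` (abc-iut-L1), `Φ(L)^rlf = (EffArithDivisor.isPerfFactorial L).Rlf` (abc-iut-L1's intrinsic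
realification, [FrdI] Def 2.4 (i)), `ι : Φ(L) → Φ(L)^pf → Φ(L)^rlf`, `Φ_{𝒞⊩_mod} = (V(L) →₀ ℝ_{≥0})` (abc-iut-L5-t2) with
`realifyMod : Φ(L) → Φ_{𝒞⊩_mod}` (abc-iut-w4-d050), `Ψ : Φ(L)^rlf ≃* Φ_{𝒞⊩_mod}` any monoid homomorphism with
`Ψ ∘ ι = realifyMod` (it exists and is unique and bijective: `EffArithDivisor.exists_rlfEquiv_realifyMod`,
`EffArithDivisor.existsUnique_rlfHom_realifyMod`), `deg^arith = arithDegree L ∘ toArithDivisor` (abc-iut-L1-t3).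

* `arithDegree_toArithDivisor_basic_inr` / `_inl` — the arithmetic degree of the BASIC divisor at `v`, i.e. of the
  divisor `e_v · [v] = ord_v(p_v) · [v]` (finite `v`) resp. the unit coordinate (archimedean `v`) that `realifyMod`
  sends to the unit vector `log⊢_mod(p_v) ↦ 1` (`realifyMod_single_absRamIdx`, `realifyMod_arch_single`): it is
  `e_v · log N(v)` resp. `[L_v : ℝ]`;
* **`arithDegree_toArithDivisor_eq_sum_realifyMod`** — `deg^arith(a) = Σ_v realifyMod(a)_v · deg^arith(basic_v)`:
  in abc-iut-L5-t2's coordinates the arithmetic degree is the linear functional with weights `e_v · log N(v)`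
  (finite) / `[L_v : ℝ]` (archimedean);
* `phiMod_degree_logMod` / `phiMod_degree_logMod_arch` — hence any additive `δ : Φ_{𝒞⊩_mod} → ℝ_{≥0}` extending
  `deg^arith` along `realifyMod` takes the value `e_v · log N(v)` on abc-iut-L5-t2's `log⊢_mod(p_v)` (`logMod`);
* **`EffArithDivisor.rlf_hom_eq_comp_of_realifyMod`** — COHERENCE OF THE TWO UNIVERSAL PROPERTIES ALONG `Ψ`: if
  `φ : Φ(L)^rlf → ℝ_{≥0}` and `δ : Φ_{𝒞⊩_mod} → ℝ_{≥0}` extend the same degree `d` on `Φ(L)` (abc-iut-L1's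
  `IsPerfFactorial.Rlf.existsUnique_hom_extending` / `existsUnique_rlf_arithDegree`, resp. abc-iut-w4-d050's
  `realifyMod_existsUnique_extension`), then `φ = δ ∘ Ψ`;
* **`EffArithDivisor.rlf_arithDegree_eq_sum_psi`** — in particular THE extension of `deg^arith` to `Φ(L)^rlf`
  ([FrdI] Thm 6.4 (i)) reads, through `Ψ`, `φ(x) = Σ_v Ψ(x)_v · deg^arith(basic_v)`;
* `EffArithDivisor.existsUnique_rlf_hom_extending` — every `ℝ_{≥0}`-valued degree on `Φ(L)` extends uniquely along
  `ι` to `Φ(L)^rlf` (existence via `Ψ` and abc-iut-w4-d050's extension along `realifyMod`, i.e. without the hypothesis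
  "`ℝ` supports `ℝ_{≥0}`" of `existsUnique_rlf_arithDegree`; uniqueness is `EffArithDivisor.rlf_hom_nnreal_ext`).
No new Prop fact; no statement of the paper is strengthened; no side is taken on [IUTchIII] Cor. 3.12.
-/

noncomputable section

open scoped Classical NNReal

namespace Literature.IUT.HodgeTheaters

open Function NumberField Literature.AlgebraicGeometry.Frobenioids Literature.AnabelianGeometry.EtaleTheta

section General

variable (L : Type) [Field L] [NumberField L]

/-! ### The arithmetic degree of the basic divisors `e_v · [v]`, `1_w` -/

/-- The arithmetic divisor underlying the effective divisor `(n · [v], 0)` is `(n · [v], 0)`.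
[cite: MochizukiFrdI2008, Ex. 6.3 p.113] -/
theorem EffArithDivisor.toArithDivisor_fin_single (v : FinitePlace L) (n : ℕ) :
    EffArithDivisor.toArithDivisor L (Finsupp.single v n, 0) = (Finsupp.single v (n : ℤ), 0) := by
  refine Prod.ext (Finsupp.ext fun v' => ?_) (funext fun w => ?_)
  · rw [EffArithDivisor.toArithDivisor_fst]
    by_cases h : v' = v
    · subst h
      rw [Finsupp.single_eq_same, Finsupp.single_eq_same]
    · rw [Finsupp.single_eq_of_ne h, Finsupp.single_eq_of_ne h, Nat.cast_zero]
  · rw [EffArithDivisor.toArithDivisor_snd]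
    rfl

/-- The arithmetic divisor underlying the effective divisor `(0, x · 1_w)` is `(0, x · 1_w)`.
[cite: MochizukiFrdI2008, Ex. 6.3 p.113] -/
theorem EffArithDivisor.toArithDivisor_arch_single (w : InfinitePlace L) (x : ℝ≥0) :
    EffArithDivisor.toArithDivisor L (0, Pi.single w x) = (0, Pi.single w (x : ℝ)) := by
  refine Prod.ext (Finsupp.ext fun v' => ?_) (funext fun w' => ?_)
  · rw [EffArithDivisor.toArithDivisor_fst]
    rfl
  · rw [EffArithDivisor.toArithDivisor_snd]
    change ((Pi.single w x : InfinitePlace L → ℝ≥0) w' : ℝ) = (Pi.single w (x : ℝ) : InfinitePlace L → ℝ) w'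
    by_cases h : w' = w
    · subst h
      rw [Pi.single_eq_same, Pi.single_eq_same]
    · rw [Pi.single_eq_of_ne h, Pi.single_eq_of_ne h, NNReal.coe_zero]

/-- `deg^arith(n · [v]) = n · log N(v)` ("the natural logarithm of the cardinality" of `𝒪_v/(λ)`, [FrdI] Ex 6.3).
[cite: MochizukiFrdI2008, Ex. 6.3 p.113] -/
theorem arithDegree_toArithDivisor_fin_single (v : FinitePlace L) (n : ℕ) :
    arithDegree L (EffArithDivisor.toArithDivisor L (Finsupp.single v n, 0)) =
      (n : ℝ) * Real.log (Ideal.absNorm v.maximalIdeal.asIdeal : ℝ) := by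
  rw [EffArithDivisor.toArithDivisor_fin_single, arithDegree_single, Int.cast_natCast]

/-- `deg^arith(0, x · 1_w) = [L_w : ℝ] · x`. [cite: MochizukiFrdI2008, Ex. 6.3 p.113] -/
theorem arithDegree_toArithDivisor_arch_single (w : InfinitePlace L) (x : ℝ≥0) :
    arithDegree L (EffArithDivisor.toArithDivisor L (0, Pi.single w x)) = (w.mult : ℝ) * (x : ℝ) := by
  rw [EffArithDivisor.toArithDivisor_arch_single, arithDegree_inf, Finset.sum_eq_single w]
  · rw [Pi.single_eq_same]
  · intro w' _ hw'
    rw [Pi.single_eq_of_ne hw', mul_zero]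
  · intro hw
    exact absurd (Finset.mem_univ w) hw

/-- **The degree of `log⊢_mod(p_v)`, finite `v`**: the basic divisor `e_v · [v] = ord_v(p_v) · [v]` (sent by `realifyMod`
to the unit vector at `v`, `realifyMod_single_absRamIdx`) has arithmetic degree `e_v · log N(v)` (`= log #(𝒪_v / p_v 𝒪_v)`).
([IUTchI] Ex 3.5 (i) p.84) [claim: Mochizuki2012, status: disputed] -/
theorem arithDegree_toArithDivisor_basic_inr (v : FinitePlace L) :
    arithDegree L (EffArithDivisor.toArithDivisor L (Finsupp.single v (absRamIdx L v), 0)) =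
      (absRamIdx L v : ℝ) * Real.log (Ideal.absNorm v.maximalIdeal.asIdeal : ℝ) :=
  arithDegree_toArithDivisor_fin_single L v _

/-- **The degree of `log⊢_mod(p_v)`, archimedean `v`** (`p_v := e`, `log(p_v) = 1`): the unit coordinate at `w` (sent by
`realifyMod` to the unit vector at `w`, `realifyMod_arch_single`) has arithmetic degree `[L_w : ℝ]`.
([IUTchI] Ex 3.5 (i) p.84) [claim: Mochizuki2012, status: disputed] -/
theorem arithDegree_toArithDivisor_basic_inl (w : InfinitePlace L) :
    arithDegree L (EffArithDivisor.toArithDivisor L (0, Pi.single w 1)) = (w.mult : ℝ) := by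
  rw [arithDegree_toArithDivisor_arch_single, NNReal.coe_one, mul_one]

/-! ### The arithmetic degree in the coordinates `log⊢_mod(p_v) ↦ 1` -/

/-- **`deg^arith(a) = Σ_v realifyMod(a)_v · deg^arith(basic_v)`**: read in abc-iut-L5-t2's coordinates of
`Φ_{𝒞⊩_mod}` (`log⊢_mod(p_v) ↦ 1`), abc-iut-L1's arithmetic degree ([FrdI] Ex 6.3) of an effective arithmetic divisor is
the linear functional with weights `e_v · log N(v)` at the finite places and `[L_w : ℝ]` at the archimedean ones.  Proof:
both sides are additive in `a`; compare them on the generators `n · [v]` and `x · 1_w`.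
([IUTchI] Ex 3.5 (i) p.84) [claim: Mochizuki2012, status: disputed] -/
theorem arithDegree_toArithDivisor_eq_sum_realifyMod (a : EffArithDivisor L) :
    arithDegree L (EffArithDivisor.toArithDivisor L a) =
      (EffArithDivisor.realifyMod L a).sum fun v t => (t : ℝ) * Sum.elim (fun w : InfinitePlace L => (w.mult : ℝ))
        (fun w : FinitePlace L => (absRamIdx L w : ℝ) * Real.log (Ideal.absNorm w.maximalIdeal.asIdeal : ℝ)) v := by
  -- the weight function and the right-hand side as an additive map
  let W : Val L → ℝ := Sum.elim (fun w : InfinitePlace L => (w.mult : ℝ))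
    (fun w : FinitePlace L => (absRamIdx L w : ℝ) * Real.log (Ideal.absNorm w.maximalIdeal.asIdeal : ℝ))
  have hWl : ∀ w : InfinitePlace L, W (Sum.inl w) = (w.mult : ℝ) := fun _ => rfl
  have hWr : ∀ w : FinitePlace L,
      W (Sum.inr w) = (absRamIdx L w : ℝ) * Real.log (Ideal.absNorm w.maximalIdeal.asIdeal : ℝ) := fun _ => rfl
  let g : Val L → ℝ≥0 → ℝ := fun v t => (t : ℝ) * W v
  have hg : ∀ v t, g v t = (t : ℝ) * W v := fun _ _ => rfl
  have hg0 : ∀ v, g v 0 = 0 := fun v => by rw [hg, NNReal.coe_zero, zero_mul]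
  have hgadd : ∀ v t s, g v (t + s) = g v t + g v s := fun v t s => by rw [hg, hg, hg, NNReal.coe_add, add_mul]
  let R : EffArithDivisor L →+ ℝ :=
    { toFun := fun a => (EffArithDivisor.realifyMod L a).sum g
      map_zero' := by rw [map_zero, Finsupp.sum_zero_index]
      map_add' := fun a b => by rw [map_add, Finsupp.sum_add_index' hg0 hgadd] }
  have hR : ∀ a, R a = (EffArithDivisor.realifyMod L a).sum g := fun _ => rfl
  let Λ : EffArithDivisor L →+ ℝ := (arithDegree L).comp (EffArithDivisor.toArithDivisor L)
  have hΛ : ∀ a, Λ a = arithDegree L (EffArithDivisor.toArithDivisor L a) := fun _ => rfl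
  -- compare on generators
  have hfin : Λ.comp (AddMonoidHom.inl _ _) = R.comp (AddMonoidHom.inl _ _) := by
    refine Finsupp.addHom_ext fun u n => ?_
    change Λ (Finsupp.single u n, 0) = R (Finsupp.single u n, 0)
    rw [hΛ, hR, arithDegree_toArithDivisor_fin_single]
    have h1 : EffArithDivisor.realifyMod L (Finsupp.single u n, 0) =
        @Finsupp.single (Val L) ℝ≥0 _ (Sum.inr u) ((n : ℝ≥0) * ((absRamIdx L u : ℝ≥0)⁻¹)) := by
      have hn : ((Finsupp.single u n, 0) : EffArithDivisor L) = n • ((Finsupp.single u 1, 0) : EffArithDivisor L) := by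
        rw [Prod.smul_mk, smul_zero, Finsupp.smul_single, smul_eq_mul, mul_one]
      rw [hn, map_nsmul, realifyMod_single_one, Finsupp.smul_single, nsmul_eq_mul]
    rw [h1, Finsupp.sum_single_index (hg0 _), hg, hWr]
    have he : (absRamIdx L u : ℝ) ≠ 0 := Nat.cast_ne_zero.mpr (absRamIdx_pos L u).ne'
    rw [NNReal.coe_mul, NNReal.coe_inv, NNReal.coe_natCast, NNReal.coe_natCast, mul_assoc, ← mul_assoc _⁻¹,
      inv_mul_cancel₀ he, one_mul]
  have harc : Λ.comp (AddMonoidHom.inr _ _) = R.comp (AddMonoidHom.inr _ _) := by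
    refine AddMonoidHom.functions_ext _ _ _ fun w x => ?_
    change Λ (0, Pi.single w x) = R (0, Pi.single w x)
    rw [hΛ, hR, arithDegree_toArithDivisor_arch_single, realifyMod_arch_single, Finsupp.sum_single_index (hg0 _), hg,
      hWl, mul_comm]
  have hΛR : Λ = R := by
    refine AddMonoidHom.ext fun d => ?_
    have h1 := DFunLike.congr_fun hfin d.1
    have h2 := DFunLike.congr_fun harc d.2
    simp only [AddMonoidHom.comp_apply, AddMonoidHom.inl_apply, AddMonoidHom.inr_apply] at h1 h2
    rw [← Prod.fst_add_snd d, map_add, map_add, h1, h2]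
  have h := DFunLike.congr_fun hΛR a
  rw [hΛ, hR] at h
  exact h

/-- The weights are nonnegative: `e_v · log N(v) ≥ 0` (`N(v) ≥ 2`) and `[L_w : ℝ] ≥ 0`.
([IUTchI] Ex 3.5 (i) p.84) [claim: Mochizuki2012, status: disputed] -/
theorem phiMod_degWeight_nonneg (v : Val L) :
    0 ≤ Sum.elim (fun w : InfinitePlace L => (w.mult : ℝ))
        (fun w : FinitePlace L => (absRamIdx L w : ℝ) * Real.log (Ideal.absNorm w.maximalIdeal.asIdeal : ℝ)) v := by
  rcases v with w | w
  · exact Nat.cast_nonneg _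
  · exact mul_nonneg (Nat.cast_nonneg _)
      (Real.log_nonneg (by exact_mod_cast (NumberField.HeightOneSpectrum.one_lt_absNorm w.maximalIdeal).le))

/-- **Any additive `δ : Φ_{𝒞⊩_mod} → ℝ_{≥0}` extending `deg^arith` along `realifyMod` is the weighted-sum functional**:
`δ(f) = Σ_v f_v · deg^arith(basic_v)` (such `δ` exists and is unique, abc-iut-w4-d050's
`realifyMod_existsUnique_extension` applied to the `ℝ_{≥0}`-valued `deg^arith` of abc-iut-L1's `exists_nnreal_arithDegree`).
([IUTchI] Ex 3.5 (i) p.84) [claim: Mochizuki2012, status: disputed] -/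
theorem phiMod_degree_eq_sum {δ : (Val L →₀ ℝ≥0) →+ ℝ≥0}
    (hδ : ∀ a : EffArithDivisor L,
      ((δ (EffArithDivisor.realifyMod L a) : ℝ≥0) : ℝ) = arithDegree L (EffArithDivisor.toArithDivisor L a))
    (f : Val L →₀ ℝ≥0) :
    ((δ f : ℝ≥0) : ℝ) = f.sum fun v t => (t : ℝ) * Sum.elim (fun w : InfinitePlace L => (w.mult : ℝ))
        (fun w : FinitePlace L => (absRamIdx L w : ℝ) * Real.log (Ideal.absNorm w.maximalIdeal.asIdeal : ℝ)) v := by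
  -- values of `δ` on the unit vectors
  have hinr : ∀ w : FinitePlace L, ((δ (@Finsupp.single (Val L) ℝ≥0 _ (Sum.inr w) 1) : ℝ≥0) : ℝ) =
      (absRamIdx L w : ℝ) * Real.log (Ideal.absNorm w.maximalIdeal.asIdeal : ℝ) := by
    intro w
    rw [← realifyMod_single_absRamIdx, hδ, arithDegree_toArithDivisor_basic_inr]
  have hinl : ∀ w : InfinitePlace L, ((δ (@Finsupp.single (Val L) ℝ≥0 _ (Sum.inl w) 1) : ℝ≥0) : ℝ) = (w.mult : ℝ) := by
    intro w
    rw [← realifyMod_arch_single, hδ, arithDegree_toArithDivisor_basic_inl]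
  conv_lhs => rw [← Finsupp.sum_single f, map_finsuppSum]
  simp only [Finsupp.sum, NNReal.coe_sum]
  refine Finset.sum_congr rfl fun v _ => ?_
  rw [phiMod_hom_single L δ, NNReal.coe_mul, mul_comm]
  rcases v with w | w
  · rw [hinl w, Sum.elim_inl]
  · rw [hinr w, Sum.elim_inr]

end General

/-! ### With abc-iut-L5-t2's name `log⊢_mod(p_v)` at `F_mod = fieldOfModuli E` -/

section Mod

variable {F : Type} {K : Type} {Fbar : Type} [Field F] [NumberField F] [Field K]
  [NumberField K] [Algebra F K] [Field Fbar] [Algebra F Fbar] [Algebra K Fbar]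
  {E : WeierstrassCurve F} [E.IsElliptic] {l : ℕ} {P : BadPlacePredicates K} (D : InitialThetaData F K Fbar E l P)

/-- **The degree of `log⊢_mod(p_v)` is `e_v · log N(v) = log #(𝒪_{(F_mod)_v} / p_v)`**: for any additive
`δ : Φ_{𝒞⊩_mod} → ℝ_{≥0}` extending abc-iut-L1's arithmetic degree along `realifyMod`, abc-iut-L5-t2's element
`InitialThetaData.logMod v` at a finite `v` of `F_mod` has `δ`-value `e_v · log N(v)`.
([IUTchI] Ex 3.5 (i) p.84) [claim: Mochizuki2012, status: disputed] -/
theorem phiMod_degree_logMod {δ : (Val (fieldOfModuli E) →₀ ℝ≥0) →+ ℝ≥0}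
    (hδ : ∀ a : EffArithDivisor (fieldOfModuli E),
      ((δ (EffArithDivisor.realifyMod (fieldOfModuli E) a) : ℝ≥0) : ℝ) =
        arithDegree (fieldOfModuli E) (EffArithDivisor.toArithDivisor (fieldOfModuli E) a))
    (v : FinitePlace (fieldOfModuli E)) :
    ((δ (D.logMod (Sum.inr v)) : ℝ≥0) : ℝ) =
      (absRamIdx (fieldOfModuli E) v : ℝ) * Real.log (Ideal.absNorm v.maximalIdeal.asIdeal : ℝ) := by
  rw [← realifyMod_logMod D, hδ, arithDegree_toArithDivisor_basic_inr]

/-- … and at an archimedean `v` of `F_mod` (`log(p_v) = 1`), `log⊢_mod(p_v)` has `δ`-value `[(F_mod)_v : ℝ]`.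
([IUTchI] Ex 3.5 (i) p.84) [claim: Mochizuki2012, status: disputed] -/
theorem phiMod_degree_logMod_arch {δ : (Val (fieldOfModuli E) →₀ ℝ≥0) →+ ℝ≥0}
    (hδ : ∀ a : EffArithDivisor (fieldOfModuli E),
      ((δ (EffArithDivisor.realifyMod (fieldOfModuli E) a) : ℝ≥0) : ℝ) =
        arithDegree (fieldOfModuli E) (EffArithDivisor.toArithDivisor (fieldOfModuli E) a))
    (v : InfinitePlace (fieldOfModuli E)) :
    ((δ (D.logMod (Sum.inl v)) : ℝ≥0) : ℝ) = (v.mult : ℝ) := by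
  rw [← realifyMod_logMod_arch D, hδ, arithDegree_toArithDivisor_basic_inl]

end Mod

/-! ### Along THE isomorphism `Ψ : Φ(L)^rlf ≃ Φ_{𝒞⊩_mod}`: coherence of the two universal properties -/

section Rlf

variable (L : Type) [Field L] [NumberField L]

/-- **Coherence of the two universal properties along `Ψ`**: abc-iut-L1's realification `Φ(L)^rlf` (with `ι`) and
abc-iut-L5-t2's `Φ_{𝒞⊩_mod}` (with `realifyMod`) both corepresent `ℝ_{≥0}`-valued degrees on `Φ(L)`
(`IsPerfFactorial.Rlf.existsUnique_hom_extending`, `realifyMod_existsUnique_extension`); for any monoid homomorphism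
`Ψ : Φ(L)^rlf → Φ_{𝒞⊩_mod}` with `Ψ ∘ ι = realifyMod` (THE isomorphism of `EffArithDivisor.exists_rlfEquiv_realifyMod`),
the two extensions `φ` (along `ι`) and `δ` (along `realifyMod`) of one degree satisfy `φ = δ ∘ Ψ`.
([IUTchI] Ex 3.5 (i) p.84) [claim: Mochizuki2012, status: disputed] -/
theorem EffArithDivisor.rlf_hom_eq_comp_of_realifyMod
    (Ψ : (EffArithDivisor.isPerfFactorial L).Rlf →* Multiplicative (Val L →₀ ℝ≥0))
    (hΨ : ∀ a : EffArithDivisor L,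
      Ψ ((EffArithDivisor.isPerfFactorial L).toRealification (Perfection.of _ (Multiplicative.ofAdd a))) =
        Multiplicative.ofAdd (EffArithDivisor.realifyMod L a))
    (φ : (EffArithDivisor.isPerfFactorial L).Rlf →* Multiplicative ℝ≥0) (δ : (Val L →₀ ℝ≥0) →+ ℝ≥0)
    (h : ∀ a : EffArithDivisor L,
      φ ((EffArithDivisor.isPerfFactorial L).toRealification (Perfection.of _ (Multiplicative.ofAdd a))) =
        Multiplicative.ofAdd (δ (EffArithDivisor.realifyMod L a))) :
    φ = (AddMonoidHom.toMultiplicative δ).comp Ψ := by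
  refine EffArithDivisor.rlf_hom_nnreal_ext L fun a => ?_
  rw [MonoidHom.comp_apply, hΨ, h, AddMonoidHom.toMultiplicative_apply_apply, toAdd_ofAdd]

/-- **Every `ℝ_{≥0}`-valued degree on `Φ(L)` extends along `ι` to `Φ(L)^rlf`** — existence through `Ψ` and
abc-iut-w4-d050's extension along `realifyMod`, WITHOUT the hypothesis "`ℝ` supports `ℝ_{≥0}`" of
`existsUnique_rlf_arithDegree`; the extension is unique (`EffArithDivisor.rlf_hom_nnreal_ext`).
([IUTchI] Ex 3.5 (i) p.84) [claim: Mochizuki2012, status: disputed] -/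
theorem EffArithDivisor.existsUnique_rlf_hom_extending (d : Multiplicative (EffArithDivisor L) →* Multiplicative ℝ≥0) :
    ∃! φ : (EffArithDivisor.isPerfFactorial L).Rlf →* Multiplicative ℝ≥0,
      φ.comp ((EffArithDivisor.isPerfFactorial L).toRealification.comp (Perfection.of _)) = d := by
  obtain ⟨Ψ, hΨ⟩ := EffArithDivisor.exists_rlfEquiv_realifyMod L
  obtain ⟨δ, hδ, -, -⟩ := realifyMod_exists_extension L (MonoidHom.toAdditive d)
  refine ⟨(AddMonoidHom.toMultiplicative δ).comp Ψ.toMonoidHom, ?_, fun φ hφ => ?_⟩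
  · refine MonoidHom.ext fun a => ?_
    rw [MonoidHom.comp_apply, MonoidHom.comp_apply, MonoidHom.comp_apply, MulEquiv.coe_toMonoidHom,
      ← ofAdd_toAdd a, hΨ, AddMonoidHom.toMultiplicative_apply_apply, toAdd_ofAdd, ← AddMonoidHom.comp_apply, hδ]
    rfl
  · refine EffArithDivisor.rlf_hom_eq_comp_of_realifyMod L Ψ.toMonoidHom (fun a => hΨ a) φ δ fun a => ?_
    rw [← AddMonoidHom.comp_apply, hδ]
    have := DFunLike.congr_fun hφ (Multiplicative.ofAdd a)
    rw [MonoidHom.comp_apply, MonoidHom.comp_apply] at this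
    rw [this]
    rfl

/-- **[FrdI] Thm 6.4 (i) "`(Φ^rlf)^gp(L) → ℝ` given by `deg_L^arith`", read through `Ψ`**: THE extension `φ` of the
(`ℝ_{≥0}`-valued) arithmetic degree `d` to `Φ(L)^rlf` (abc-iut-L1's `existsUnique_rlf_arithDegree`,
`exists_nnreal_arithDegree`) is, in abc-iut-L5-t2's coordinates, `φ(x) = Σ_v Ψ(x)_v · deg^arith(basic_v)` with the weights
`e_v · log N(v)` / `[L_w : ℝ]`. ([IUTchI] Ex 3.5 (i) p.84) [claim: Mochizuki2012, status: disputed] -/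
theorem EffArithDivisor.rlf_arithDegree_eq_sum_psi
    (Ψ : (EffArithDivisor.isPerfFactorial L).Rlf →* Multiplicative (Val L →₀ ℝ≥0))
    (hΨ : ∀ a : EffArithDivisor L,
      Ψ ((EffArithDivisor.isPerfFactorial L).toRealification (Perfection.of _ (Multiplicative.ofAdd a))) =
        Multiplicative.ofAdd (EffArithDivisor.realifyMod L a))
    (d : Multiplicative (EffArithDivisor L) →* Multiplicative ℝ≥0)
    (hd : ∀ a : EffArithDivisor L,
      ((Multiplicative.toAdd (d (Multiplicative.ofAdd a)) : ℝ≥0) : ℝ) =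
        arithDegree L (EffArithDivisor.toArithDivisor L a))
    (φ : (EffArithDivisor.isPerfFactorial L).Rlf →* Multiplicative ℝ≥0)
    (hφ : φ.comp ((EffArithDivisor.isPerfFactorial L).toRealification.comp (Perfection.of _)) = d)
    (x : (EffArithDivisor.isPerfFactorial L).Rlf) :
    ((Multiplicative.toAdd (φ x) : ℝ≥0) : ℝ) =
      (Multiplicative.toAdd (Ψ x)).sum fun v t => (t : ℝ) * Sum.elim (fun w : InfinitePlace L => (w.mult : ℝ))
        (fun w : FinitePlace L => (absRamIdx L w : ℝ) * Real.log (Ideal.absNorm w.maximalIdeal.asIdeal : ℝ)) v := by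
  -- the extension of `d` along `realifyMod`
  obtain ⟨δ, hδ, -, -⟩ := realifyMod_exists_extension L (MonoidHom.toAdditive d)
  have hδ' : ∀ a : EffArithDivisor L,
      ((δ (EffArithDivisor.realifyMod L a) : ℝ≥0) : ℝ) = arithDegree L (EffArithDivisor.toArithDivisor L a) := by
    intro a
    rw [← AddMonoidHom.comp_apply, hδ, ← hd]
    rfl
  have hφδ : φ = (AddMonoidHom.toMultiplicative δ).comp Ψ := by
    refine EffArithDivisor.rlf_hom_eq_comp_of_realifyMod L Ψ hΨ φ δ fun a => ?_
    rw [← AddMonoidHom.comp_apply, hδ]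
    have := DFunLike.congr_fun hφ (Multiplicative.ofAdd a)
    rw [MonoidHom.comp_apply, MonoidHom.comp_apply] at this
    rw [this]
    rfl
  rw [hφδ, MonoidHom.comp_apply, ← ofAdd_toAdd (Ψ x), AddMonoidHom.toMultiplicative_apply_apply, toAdd_ofAdd,
    toAdd_ofAdd, phiMod_degree_eq_sum L hδ']

end Rlf

end Literature.IUT.HodgeTheaters

end
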